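import Literature.Geometry.Symplectic.NearSymplecticModelChartsReduction
import Literature.Geometry.Symplectic.NearSymplecticZeroCircles
import HarnessLib

/-!
# `relNearSymplecticTaubesTubes_exists` from two even zero circles and Honda's normal form

Topic `Literature/Geometry/Symplectic` (groundwork `--supports`
`Literature.Geometry.Symplectic.relNearSymplecticTaubesTubes_exists`; everything here is PROVED,
no named fact is introduced).

`NearSymplecticModelChartsReduction.lean` reduced the named fact to the existence, on every
punctured homotopy `4`-sphere, of an asymptotically standard form with two disjoint Honda model
charts (`relNearSymplecticTaubesTubes_exists_of_hondaModelCharts`).  With the vocabulary of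
`NearSymplecticForms.lean` (Perutz 2006, Def. 1.1) and `NearSymplecticZeroCircles.lean` (zero
circles and their parity, Perutz 2006, Prop. 2.2) this file splits that hypothesis into the two
published statements it is made of, both taken as HYPOTHESES (binders, not named facts):

* **(G) existence with two untwisted circles** — Gerig 2021, Thm. 1.6 with §1 (p. 4) and §3
  (first paragraph, `N = 2`): for every homotopy `4`-sphere `Σ` and `p ∈ Σ` there is a
  near-symplectic form on `Σ ∖ p` (for an orientation of `Σ ∖ p`), standard on a punctured
  chart-ball about `p`, whose zero set consists of exactly two disjoint EVEN zero circles;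
* **(H) Honda's normal form along an even circle** — Honda 2004, §4 Thm. 5 (with Thm. 4 (A)),
  re-proved as Perutz 2006, Lemma 3.1 (and its footnote: the deformation may be taken through
  near-symplectic forms with fixed zero set): a near-symplectic form can be modified inside any
  neighbourhood `N` of an even zero circle `Γ`, keeping it near-symplectic with the same zero
  set, so that afterwards `Γ` has a Honda model chart inside `N` (`IsHondaModelChartIn`: a
  `2π`-periodic `χ : ℝ_θ × ℝ³ → Σ ∖ p`, on `ℝ × B³(r)` smooth, immersive, injective mod `2πℤ e_θ`,
  with image in `N`, pulling the form back to `ω_A = hondaFormA`, and with `χ(ℝ × 0) = Γ`);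

and PROVES `relNearSymplecticTaubesTubes_exists` from (G) and (H)
(`relNearSymplecticTaubesTubes_exists_of_twoEvenCircles_of_hondaNormalForm`).

**Caveat on (H) (added after `NearSymplecticDefinite.lean`).**  Both hypotheses are phrased here
with `IsNearSymplectic`, the verbatim transcription of Perutz 2006, Def. 1.1 (rank-`3` gradient
at the zeros).  That printed definition is strictly WEAKER than the definite notion for which (H)
is proved in the literature (Honda's self-dual harmonic forms; Perutz's proof of Lemma 3.1 begins
"take a metric `g` for which `ω` is self-dual"): `perutzDegenerateForm` of
`NearSymplecticDefinite.lean` is near-symplectic in the sense of `IsNearSymplectic` but admits no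
such metric.  So (H) as stated below is stronger than Honda's theorem (it also covers degenerate
forms, for which nothing is in print), while (G) is unaffected.  The faithful transcription —
both hypotheses phrased with `IsStrictlyNearSymplectic` — is
`relNearSymplecticTaubesTubes_exists_of_twoEvenCircles_of_hondaNormalForm_strict`
(`NearSymplecticTwoCirclesReductionStrict.lean`); the present theorem remains a valid implication.

The glue: separate
the two circles and the puncture by disjoint open sets `N₁, N₂, U₀` of `Σ` (compact Hausdorff);
apply (H) in `N₁`, transport the evenness of the second circle (the form is unchanged on `N₂`;
`IsEvenZeroCircle.congr`), apply (H) in `N₂`, transport the first chart (the form is unchanged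
on `N₁`; `IsHondaModelChartIn.congr`); shrink the ball into `U₀` so that it misses `N₁ ∪ N₂`
(then the form is still standard there and the tubes avoid it); non-degeneracy off the two axes
is near-positivity off the (unchanged) zero set.

## References

* C. Gerig, *No homotopy 4-sphere invariants using ECH=SWF*, Algebr. Geom. Topol. 21 (2021),
  Thm. 1.6, §1, §3 [Gerig2021NoHomotopySphereInvariants].
* K. Honda, *Local properties of self-dual harmonic 2-forms on a 4-manifold*, J. reine angew.
  Math. 577 (2004), §4 Thm. 4 (A), Thm. 5 [Honda2004LocalSD].
* T. Perutz, *Zero-sets of near-symplectic forms*, J. Symplectic Geom. 4 (2006), Thm. 1.4,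
  Thm. 1.8, Prop. 2.2, Lemma 3.1 [Perutz2006].
-/

noncomputable section

open scoped Manifold ContDiff Topology Real
open Set Function Filter Bundle Literature.Geometry.Kaehler Literature.Topology.FourManifolds

namespace Literature.Geometry.Symplectic

/-- Local notation for the model space `ℝ⁴ = EuclideanSpace ℝ (Fin 4)`. -/
local notation "E4" => EuclideanSpace ℝ (Fin 4)

/-! ### Honda model charts inside a set -/

section Generic

variable {M : Type*} [TopologicalSpace M] [ChartedSpace E4 M]

/-- **A Honda model chart of radius `r` for `sf` inside the set `N`**: as `IsHondaModelChart`
(`NearSymplecticModelChartsReduction.lean`) but on an arbitrary `4`-manifold `M` and with the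
ball-avoidance clause replaced by `χ(ℝ × B³(r)) ⊆ N` — the conclusion of Honda 2004, §4 Thm. 5
(normal form (A)) / Perutz 2006, Lemma 3.1 "on a neighbourhood of `Z`", the neighbourhood being
prescribed. [cite: Honda2004LocalSD, §4 Thm. 4 (A) and Thm. 5] -/
structure IsHondaModelChartIn (N : Set M) (r : ℝ) (sf : MForm (𝓡 4) M ℝ 2) (χ : E4 → M) :
    Prop where
  /-- `χ` is `2π`-periodic in the angular coordinate. -/
  periodic : ∀ q : E4, χ (q + (2 * π) • EuclideanSpace.single 0 1) = χ q
  /-- `χ` is smooth on the model tube. -/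
  contMDiffOn : ContMDiffOn 𝓘(ℝ, E4) (𝓡 4) ∞ χ (hondaTube r)
  /-- `χ` is injective on the model tube modulo the period lattice `2πℤ · e_θ`. -/
  eq_add_of_eq : ∀ q ∈ hondaTube r, ∀ q' ∈ hondaTube r, χ q' = χ q →
    ∃ k : ℤ, q' = q + (2 * π * k) • EuclideanSpace.single 0 1
  /-- `χ` is an immersion on the model tube. -/
  injective_mfderiv : ∀ q ∈ hondaTube r, Function.Injective (mfderiv 𝓘(ℝ, E4) (𝓡 4) χ q)
  /-- The image of the model tube lies in `N`. -/
  image_subset : χ '' hondaTube r ⊆ N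
  /-- `χ* sf = ω_A` on the model tube. -/
  pullback_eq : ∀ q ∈ hondaTube r, ∀ U V : E4,
    sf (χ q) ![mfderiv 𝓘(ℝ, E4) (𝓡 4) χ q U, mfderiv 𝓘(ℝ, E4) (𝓡 4) χ q V] = hondaFormA q U V

namespace IsHondaModelChartIn

variable {N : Set M} {r : ℝ} {sf sf' : MForm (𝓡 4) M ℝ 2} {χ : E4 → M}

/-- **A Honda model chart inside `N` only sees the form on `N`**: it remains one for every form
agreeing with `sf` on `N`. [folklore] -/
theorem congr (h : IsHondaModelChartIn N r sf χ) (heq : ∀ x ∈ N, sf' x = sf x) :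
    IsHondaModelChartIn N r sf' χ where
  periodic := h.periodic
  contMDiffOn := h.contMDiffOn
  eq_add_of_eq := h.eq_add_of_eq
  injective_mfderiv := h.injective_mfderiv
  image_subset := h.image_subset
  pullback_eq q hq U V := by
    rw [heq _ (h.image_subset ⟨q, hq, rfl⟩)]
    exact h.pullback_eq q hq U V

/-- Shrinking the radius keeps a Honda model chart inside `N`. [folklore] -/
theorem mono_radius (h : IsHondaModelChartIn N r sf χ) {r' : ℝ} (hr' : 0 ≤ r') (hle : r' ≤ r) :
    IsHondaModelChartIn N r' sf χ where
  periodic := h.periodic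
  contMDiffOn := h.contMDiffOn.mono (hondaTube_mono hr' hle)
  eq_add_of_eq q hq q' hq' := h.eq_add_of_eq q (hondaTube_mono hr' hle hq) q'
    (hondaTube_mono hr' hle hq')
  injective_mfderiv q hq := h.injective_mfderiv q (hondaTube_mono hr' hle hq)
  image_subset := (image_mono (hondaTube_mono hr' hle)).trans h.image_subset
  pullback_eq q hq := h.pullback_eq q (hondaTube_mono hr' hle hq)

/-- Enlarging the ambient set keeps a Honda model chart. [folklore] -/
theorem mono_set (h : IsHondaModelChartIn N r sf χ) {N' : Set M} (hN : N ⊆ N') :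
    IsHondaModelChartIn N' r sf χ where
  periodic := h.periodic
  contMDiffOn := h.contMDiffOn
  eq_add_of_eq := h.eq_add_of_eq
  injective_mfderiv := h.injective_mfderiv
  image_subset := h.image_subset.trans hN
  pullback_eq := h.pullback_eq

end IsHondaModelChartIn

/-- **On `M ∖ p`, a Honda model chart inside a set missing the punctured `ε`-ball is a Honda
model chart off that ball** (`IsHondaModelChart` of `NearSymplecticModelChartsReduction.lean`).
[folklore] -/
theorem IsHondaModelChartIn.isHondaModelChart {M₀ : Type*} [TopologicalSpace M₀]
    [ChartedSpace E4 M₀] [T1Space M₀] {p : M₀} {ε r : ℝ} {N : Set (punctured p)}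
    {sf : MForm (𝓡 4) (punctured p) ℝ 2} {χ : E4 → punctured p}
    (h : IsHondaModelChartIn N r sf χ) (hN : ∀ x ∈ N, ¬ InPuncturedChartBall p ε x) :
    IsHondaModelChart p ε r sf χ where
  periodic := h.periodic
  contMDiffOn := h.contMDiffOn
  eq_add_of_eq := h.eq_add_of_eq
  injective_mfderiv := h.injective_mfderiv
  not_inPuncturedChartBall q hq := hN _ (h.image_subset ⟨q, hq, rfl⟩)
  pullback_eq := h.pullback_eq

end Generic

/-! ### Locality of the gradient, of zero circles and of their parity -/

section Locality

variable {M : Type*} [TopologicalSpace M] [ChartedSpace E4 M]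

/-- **Locality of the chart gradient**: forms that agree near `z` have the same `zeroGradient`
at `z` (locality of the chart representative, `MForm.inChart_eventuallyEq`). [folklore] -/
theorem zeroGradient_congr_of_eventuallyEq {α β : MForm (𝓡 4) M ℝ 2} {z : M}
    (h : ∀ᶠ w in 𝓝 z, α w = β w) : zeroGradient α z = zeroGradient β z :=
  (MForm.inChart_eventuallyEq (mem_extChartAt_source (I := 𝓡 4) z) h).fderiv_eq

/-- Locality of Perutz's form at a zero. [folklore] -/
theorem zeroNormalForm_congr_of_eventuallyEq {α β : MForm (𝓡 4) M ℝ 2} {z : M}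
    (h : ∀ᶠ w in 𝓝 z, α w = β w) (τ : E4) : zeroNormalForm α z τ = zeroNormalForm β z τ := by
  funext v w
  rw [zeroNormalForm_apply, zeroNormalForm_apply, zeroGradient_congr_of_eventuallyEq h]

/-- **A zero circle of `α` is a zero circle of every form agreeing with `α` along it.**
[folklore] -/
theorem IsZeroCircle.congr {α β : MForm (𝓡 4) M ℝ 2} {γ : ℝ → M} (h : IsZeroCircle α γ)
    (heq : ∀ θ : ℝ, β (γ θ) = α (γ θ)) : IsZeroCircle β γ where
  periodic := h.periodic
  contMDiff := h.contMDiff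
  injective_mfderiv := h.injective_mfderiv
  eq_add_of_eq := h.eq_add_of_eq
  mem_zeroLocus θ := by
    change β (γ θ) = 0
    rw [heq]
    exact h.mem_zeroLocus θ

variable [IsManifold (𝓡 4) ∞ M]

/-- **Parity is local**: an even zero circle of `α` is an even zero circle of every form `β`
agreeing with `α` on an open set containing the circle (the witnessing section is unchanged,
Perutz's forms `S` of `α` and `β` coinciding along the circle). [folklore] -/
theorem IsEvenZeroCircle.congr {α β : MForm (𝓡 4) M ℝ 2} {γ : ℝ → M} (h : IsEvenZeroCircle α γ)
    {U : Set M} (hU : IsOpen U) (hγU : range γ ⊆ U) (heq : ∀ x ∈ U, β x = α x) :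
    IsEvenZeroCircle β γ := by
  obtain ⟨hz, V, hVper, hVcont, hVmin⟩ := h
  refine ⟨hz.congr fun θ => heq _ (hγU ⟨θ, rfl⟩), V, hVper, hVcont, fun θ => ?_⟩
  have hev : ∀ᶠ w in 𝓝 (γ θ), β w = α w :=
    Filter.eventually_of_mem (hU.mem_nhds (hγU ⟨θ, rfl⟩)) heq
  rw [zeroNormalForm_congr_of_eventuallyEq hev]
  exact hVmin θ

end Locality

/-! ### The range of a zero circle is compact -/

section Compact

variable {M : Type*} [TopologicalSpace M] [ChartedSpace E4 M]

/-- A `2π`-periodic curve is determined by one period: `range γ = γ([0, 2π])`. [folklore] -/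
theorem IsZeroCircle.range_eq_image_Icc {α : MForm (𝓡 4) M ℝ 2} {γ : ℝ → M}
    (h : IsZeroCircle α γ) : range γ = γ '' Icc 0 (2 * π) := by
  refine Subset.antisymm ?_ (image_subset_range _ _)
  rintro _ ⟨θ, rfl⟩
  refine ⟨toIcoMod Real.two_pi_pos 0 θ, ?_, ?_⟩
  · have hm := toIcoMod_mem_Ico Real.two_pi_pos 0 θ
    exact ⟨hm.1, by linarith [hm.2]⟩
  · have hk : toIcoMod Real.two_pi_pos 0 θ =
        θ + 2 * π * ((-toIcoDiv Real.two_pi_pos 0 θ : ℤ) : ℝ) := by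
      rw [toIcoMod, zsmul_eq_mul]; push_cast; ring
    rw [hk, h.periodic_int]

/-- **The range of a zero circle is compact.** [folklore] -/
theorem IsZeroCircle.isCompact_range {α : MForm (𝓡 4) M ℝ 2} {γ : ℝ → M}
    (h : IsZeroCircle α γ) : IsCompact (range γ) := by
  rw [h.range_eq_image_Icc]
  exact isCompact_Icc.image h.contMDiff.continuous

end Compact

/-! ### Small punctured chart-balls avoid a given neighbourhood complement -/

section Ball

variable {M₀ : Type*} [TopologicalSpace M₀] [ChartedSpace E4 M₀] [T1Space M₀]

/-- **Small punctured chart-balls stay in a prescribed neighbourhood of the puncture**: if `U₀`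
is a neighbourhood of `p`, then for some `ε' ∈ (0, ε]` every point of the punctured `ε'`-ball
lies in `U₀` (continuity of the inverse extended chart at `e p`). [folklore] -/
theorem exists_puncturedChartBall_subset {p : M₀} {ε : ℝ} (hε : 0 < ε)
    {U₀ : Set M₀} (hU₀ : U₀ ∈ 𝓝 p) :
    ∃ ε' : ℝ, 0 < ε' ∧ ε' ≤ ε ∧
      ∀ x : punctured p, InPuncturedChartBall p ε' x → x.1 ∈ U₀ := by
  set e := extChartAt (𝓡 4) p with he
  have hcont : ContinuousAt e.symm (e p) := continuousAt_extChartAt_symm p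
  have hU₀' : U₀ ∈ 𝓝 (e.symm (e p)) := by rwa [extChartAt_to_inv (I := 𝓡 4) p]
  obtain ⟨δ, hδ, hδU⟩ := Metric.mem_nhds_iff.1 (hcont hU₀')
  refine ⟨min δ ε, lt_min hδ hε, min_le_right _ _, fun x hx => ?_⟩
  have hxs : x.1 ∈ e.source := by rw [he, extChartAt_source]; exact hx.1
  have hxt : e x.1 ∈ Metric.ball (e p) δ := Metric.ball_subset_ball (min_le_left _ _) hx.2
  have := hδU hxt
  rwa [mem_preimage, e.left_inv hxs] at this

end Ball

/-! ### The reduction -/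

/-- **`relNearSymplecticTaubesTubes_exists` from (G) two even zero circles and (H) Honda's normal
form along an even circle** (module docstring): if
(G) for every homotopy `4`-sphere `Σ` and `p ∈ Σ` there are `ε > 0` with
`closedBall (e p) ε ⊆ e.target`, an orientation `o` of `Σ ∖ p`, an `o`-near-symplectic `2`-form
`sf` on `Σ ∖ p` standard on the punctured `ε`-chart-ball, and two even zero circles `γ₁, γ₂` of
`sf` with disjoint ranges exhausting the zero locus of `sf` (Gerig 2021, Thm. 1.6, §1 p. 4, §3
par. 1 with `N = 2`; Perutz 2006, Thm. 1.4, Thm. 1.8); and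
(H) on every punctured homotopy `4`-sphere, every `o`-near-symplectic form `sf` with an even zero
circle `γ` can be replaced, inside any open `N ⊇ γ(ℝ)`, by an `o`-near-symplectic form `sf'`
with `sf' = sf` off `N`, the same zero locus, and a Honda model chart of some radius `r > 0`
inside `N` whose axis image is `γ(ℝ)` (Honda 2004, §4 Thm. 5 with Thm. 4 (A); Perutz 2006,
Lemma 3.1 and footnote — proved in print for the DEFINITE case only: see the caveat in the
module docstring and the strict version
`relNearSymplecticTaubesTubes_exists_of_twoEvenCircles_of_hondaNormalForm_strict`);
then `relNearSymplecticTaubesTubes_exists` holds. [cite: Gerig2021NoHomotopySphereInvariants, Thm. 1.6 and §3 (first par.)] -/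
theorem relNearSymplecticTaubesTubes_exists_of_twoEvenCircles_of_hondaNormalForm
    (hG : ∀ (S : Literature.Topology.FourManifolds.HomotopySphere 4) (p : S.carrier),
      ∃ (ε : ℝ) (o : SmoothOrientation (𝓡 4) (punctured p))
        (sf : MForm (𝓡 4) (punctured p) ℝ 2) (γ₁ γ₂ : ℝ → punctured p),
        0 < ε ∧ Metric.closedBall (extChartAt (𝓡 4) p p) ε ⊆ (extChartAt (𝓡 4) p).target ∧
        IsNearSymplectic o sf ∧ IsStandardOnBall p ε sf ∧
        IsEvenZeroCircle sf γ₁ ∧ IsEvenZeroCircle sf γ₂ ∧ Disjoint (range γ₁) (range γ₂) ∧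
        zeroLocus sf = range γ₁ ∪ range γ₂)
    (hH : ∀ (S : Literature.Topology.FourManifolds.HomotopySphere 4) (p : S.carrier)
      (o : SmoothOrientation (𝓡 4) (punctured p)) (sf : MForm (𝓡 4) (punctured p) ℝ 2)
      (γ : ℝ → punctured p) (N : Set (punctured p)),
      IsNearSymplectic o sf → IsEvenZeroCircle sf γ → IsOpen N → range γ ⊆ N →
      ∃ (sf' : MForm (𝓡 4) (punctured p) ℝ 2) (r : ℝ) (χ : E4 → punctured p),
        IsNearSymplectic o sf' ∧ (∀ x : punctured p, x ∉ N → sf' x = sf x) ∧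
        zeroLocus sf' = zeroLocus sf ∧ 0 < r ∧ IsHondaModelChartIn N r sf' χ ∧
        χ '' hondaAxis = range γ) :
    relNearSymplecticTaubesTubes_exists := by
  refine relNearSymplecticTaubesTubes_exists_of_hondaModelCharts fun S p => ?_
  obtain ⟨ε, o, sf, γ₁, γ₂, hε, hball, hns, hstd, h₁, h₂, hdisj, hZ⟩ := hG S p
  -- Step 0: separate the two circles and the puncture in `Σ`
  set K₁ : Set S.carrier := Subtype.val '' range γ₁ with hK₁
  set K₂ : Set S.carrier := Subtype.val '' range γ₂ with hK₂
  have hK₁c : IsCompact K₁ := h₁.isZeroCircle.isCompact_range.image continuous_subtype_val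
  have hK₂c : IsCompact K₂ := h₂.isZeroCircle.isCompact_range.image continuous_subtype_val
  have hpK₁ : p ∉ K₁ := by rintro ⟨x, -, hx⟩; exact (mem_punctured.1 x.2) hx
  have hpK₂ : p ∉ K₂ := by rintro ⟨x, -, hx⟩; exact (mem_punctured.1 x.2) hx
  have hK₁₂ : Disjoint K₁ K₂ := by
    rw [hK₁, hK₂, disjoint_image_iff Subtype.val_injective]; exact hdisj
  obtain ⟨U₁, U₂, hU₁o, hU₂o, hKU₁, hKU₂, hU₁₂⟩ :=
    SeparatedNhds.of_isCompact_isCompact hK₁c hK₂c hK₁₂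
  obtain ⟨V₁, W₁, hV₁o, hW₁o, hKV₁, hpW₁, hVW₁⟩ :=
    SeparatedNhds.of_isCompact_isCompact hK₁c isCompact_singleton
      (disjoint_singleton_right.2 hpK₁)
  obtain ⟨V₂, W₂, hV₂o, hW₂o, hKV₂, hpW₂, hVW₂⟩ :=
    SeparatedNhds.of_isCompact_isCompact hK₂c isCompact_singleton
      (disjoint_singleton_right.2 hpK₂)
  -- the open sets of `Σ ∖ p` in which (H) is applied
  set N₁ : Set (punctured p) := Subtype.val ⁻¹' (U₁ ∩ V₁) with hN₁
  set N₂ : Set (punctured p) := Subtype.val ⁻¹' (U₂ ∩ V₂) with hN₂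
  have hN₁o : IsOpen N₁ := (hU₁o.inter hV₁o).preimage continuous_subtype_val
  have hN₂o : IsOpen N₂ := (hU₂o.inter hV₂o).preimage continuous_subtype_val
  have hγN₁ : range γ₁ ⊆ N₁ := fun x hx =>
    ⟨hKU₁ ⟨x, hx, rfl⟩, hKV₁ ⟨x, hx, rfl⟩⟩
  have hγN₂ : range γ₂ ⊆ N₂ := fun x hx =>
    ⟨hKU₂ ⟨x, hx, rfl⟩, hKV₂ ⟨x, hx, rfl⟩⟩
  have hN₁₂ : Disjoint N₁ N₂ := by
    rw [hN₁, hN₂, Set.disjoint_left]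
    intro x hx hx'
    exact Set.disjoint_left.1 hU₁₂ hx.1 hx'.1
  -- Step 1: Honda's normal form along `γ₁` inside `N₁`
  obtain ⟨sf₁, r₁, χ₁, hns₁, heq₁, hZ₁, hr₁, hc₁, hax₁⟩ := hH S p o sf γ₁ N₁ hns h₁ hN₁o hγN₁
  -- `γ₂` is still an even zero circle of `sf₁` (the form is unchanged on `N₂`)
  have h₂' : IsEvenZeroCircle sf₁ γ₂ :=
    h₂.congr hN₂o hγN₂ fun x hx => heq₁ x (Set.disjoint_right.1 hN₁₂ hx)
  -- Step 2: Honda's normal form along `γ₂` inside `N₂`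
  obtain ⟨sf₂, r₂, χ₂, hns₂, heq₂, hZ₂, hr₂, hc₂, hax₂⟩ :=
    hH S p o sf₁ γ₂ N₂ hns₁ h₂' hN₂o hγN₂
  -- the first chart survives (the form is unchanged on `N₁`)
  have hc₁' : IsHondaModelChartIn N₁ r₁ sf₂ χ₁ :=
    hc₁.congr fun x hx => heq₂ x (Set.disjoint_left.1 hN₁₂ hx)
  -- Step 3: shrink the ball into `W₁ ∩ W₂`, which misses `N₁ ∪ N₂`
  obtain ⟨ε', hε', hε'ε, hballW⟩ := exists_puncturedChartBall_subset (p := p) hε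
    ((hW₁o.inter hW₂o).mem_nhds ⟨hpW₁ rfl, hpW₂ rfl⟩)
  have hN₁ball : ∀ x ∈ N₁, ¬ InPuncturedChartBall p ε' x := fun x hx hb =>
    Set.disjoint_left.1 hVW₁ hx.2 (hballW x hb).1
  have hN₂ball : ∀ x ∈ N₂, ¬ InPuncturedChartBall p ε' x := fun x hx hb =>
    Set.disjoint_left.1 hVW₂ hx.2 (hballW x hb).2
  -- common radius
  set r : ℝ := min r₁ r₂ with hr_def
  have hr : 0 < r := lt_min hr₁ hr₂
  have hC₁ : IsHondaModelChart p ε' r sf₂ χ₁ :=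
    (hc₁'.mono_radius hr.le (min_le_left _ _)).isHondaModelChart hN₁ball
  have hC₂ : IsHondaModelChart p ε' r sf₂ χ₂ :=
    (hc₂.mono_radius hr.le (min_le_right _ _)).isHondaModelChart hN₂ball
  refine ⟨ε', r, sf₂, χ₁, χ₂, hε', (Metric.closedBall_subset_closedBall hε'ε).trans hball, hr,
    hns₂.isSmoothForm, hns₂.isClosedForm, ?_, hC₁, hC₂, ?_, ?_⟩
  · -- standard on the smaller ball: there `sf₂ = sf₁ = sf`
    intro x hx v w
    have hx₁ : x ∉ N₁ := fun h => hN₁ball x h hx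
    have hx₂ : x ∉ N₂ := fun h => hN₂ball x h hx
    rw [heq₂ x hx₂, heq₁ x hx₁]
    exact hstd.anti hε'ε x hx v w
  · -- the tube images are disjoint: they lie in `N₁`, `N₂`
    refine hN₁₂.mono ?_ ?_
    · exact (image_mono (hondaTube_mono hr.le (min_le_left _ _))).trans hc₁.image_subset
    · exact (image_mono (hondaTube_mono hr.le (min_le_right _ _))).trans hc₂.image_subset
  · -- non-degenerate off the two axes = off the (unchanged) zero locus
    intro x hx v hv
    refine hns₂.nondegenerate_of_not_mem ?_ v hv
    rw [hZ₂, hZ₁, hZ]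
    rintro (hx' | hx')
    · exact hx (Or.inl (hax₁ ▸ hx'))
    · exact hx (Or.inr (hax₂ ▸ hx'))

end Literature.Geometry.Symplectic

end
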